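import Literature.MathematicalPhysics.QuantumFieldTheory.TransferDecayUpgrade
import Summits.QuantumFields.QCD.Theorems.QuarksNoInfraredClauseTorusHalfSpectrumStubHaagProductBound
import HarnessLib

/-!
# Stub `stub_euclidean_haag_product_bound` (E5) of line `registered`
(skeleton `Cruxes/TorusHalfSpectrum/Lines/birth.lean`, crux
`Summit.QuantumFields.QCD.Theses.QuarksNoInfraredClause.TorusHalfSpectrum`, item stmt-QuantumFields-9508,
route route-QuantumFields-QuarksNoInfraredClause)

## Summary

The Euclidean (measure) form of Haag's product bound (the operator half is the landed stub E4,
`HaagProductBound.stub_haag_product_bound`; Haag, Local Quantum Physics, Thm. II.5.4.1).  Let `μ` be a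
probability measure realised in the Osterwalder–Schrader sense by `IsOSRealisation μ reflect shift m₊ ι D`, and
let `σ` be a "spatial" shift commuting with the time reflection `reflect` and the time shift `shift`, preserving
positive-time measurability, and under which `μ` is MIXING on bounded measurable observables.  Let `F` be a bounded
positive-time observable with `∫ F dμ = 0` ("charged") and `Fc` a bounded positive-time partner.  If every NEUTRAL
composite `N_j ω = F ω · Fc (σʲ ω)` clusters eventually in time at rate `r²` (own constant, own threshold), then
for EVERY `n`
`Re ∫ conj (F ∘ reflect) · F ∘ shiftⁿ dμ · Re ∫ conj (Fc ∘ reflect) · Fc ∘ shiftⁿ dμ ≤ (M_F M_{Fc})² (r²)ⁿ`.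

Proof.  Apply E4 on the OS Hilbert space with `v = ι F`, `v' = ι Fc`, `w_j = ι N_j`, `M = |M_F M_{Fc}|`:
(1) the neutral decay hypothesis is E4's clustering hypothesis by the OS dictionary
(`integral_conj_comp_reflect_mul_comp_iterate`, `integral_conj_comp_reflect`, `integral_eq_inner_vacuum`);
(2) `‖w_j‖² = Re ∫ conj (N_j ∘ reflect) N_j dμ ≤ (M_F M_{Fc})²` (`re_integral_conj_comp_reflect_mul_self`,
`norm_integral_le_of_norm_le_const`); (3) no long-range order `⟪Ω, w_j⟫ = ∫ F · Fc ∘ σʲ dμ → (∫ F)(∫ Fc) = 0`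
by mixing; (4) splitting `⟪w_j, Tⁿ w_j⟫ = ∫ P · Q ∘ σʲ dμ → (∫ P)(∫ Q) = ⟪ι F, Tⁿ ι F⟫ ⟪ι Fc, Tⁿ ι Fc⟫` by
mixing, with `P = conj (F ∘ reflect) · F ∘ shiftⁿ`, `Q = conj (Fc ∘ reflect) · Fc ∘ shiftⁿ`, using that `σ`
commutes with `reflect` and `shift`.  E4's conclusion is translated back to integrals by the same dictionary.
-/

namespace Summit.QuantumFields.QCD.Cruxes.TorusHalfSpectrum.Birth.EuclideanHaag

open MeasureTheory Filter Topology
open scoped InnerProductSpace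
open Literature.Probability.LatticeModels

/-- Norm bound for `conj a * b` from bounds on `‖a‖` and `‖b‖` (in `ℂ`). -/
theorem norm_conj_mul_le {a b : ℂ} {A B : ℝ} (ha : ‖a‖ ≤ A) (hb : ‖b‖ ≤ B) :
    ‖starRingEnd ℂ a * b‖ ≤ A * B := by
  rw [norm_mul, Complex.norm_conj]
  exact mul_le_mul ha hb (norm_nonneg _) ((norm_nonneg _).trans ha)

/-- Norm bound for a product `a * b` from bounds on `‖a‖` and `‖b‖` (in `ℂ`). -/
theorem norm_mul_le_of_le {a b : ℂ} {A B : ℝ} (ha : ‖a‖ ≤ A) (hb : ‖b‖ ≤ B) : ‖a * b‖ ≤ A * B := by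
  rw [norm_mul]
  exact mul_le_mul ha hb (norm_nonneg _) ((norm_nonneg _).trans ha)

/-- Pointwise-commuting self-maps have commuting iterates: `f (g^[j] x) = g^[j] (f x)`
(`Function.Commute.iterate_right`). -/
theorem apply_iterate_comm {α : Type*} {f g : α → α} (h : ∀ x, f (g x) = g (f x)) (j : ℕ) (x : α) :
    f (g^[j] x) = g^[j] (f x) :=
  Function.Commute.iterate_right h j x

/-- Pointwise-commuting self-maps have commuting iterates: `f^[n] (g^[j] x) = g^[j] (f^[n] x)`
(`Function.Commute.iterate_iterate`). -/
theorem iterate_iterate_comm {α : Type*} {f g : α → α} (h : ∀ x, f (g x) = g (f x)) (n j : ℕ)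
    (x : α) : f^[n] (g^[j] x) = g^[j] (f^[n] x) :=
  Function.Commute.iterate_iterate h n j x

/-- If composition with `σ` preserves `m₊`-measurability of complex observables, so does composition with every
iterate `σ^[j]` (pattern of `IsOSRealisation.isBoundedMeasurable_comp_iterate`). -/
theorem measurable_comp_iterate_of_comp {Ω : Type*} {mpos : MeasurableSpace Ω} {σ : Ω → Ω}
    (hσ : ∀ G : Ω → ℂ, Measurable[mpos] G → Measurable[mpos] (G ∘ σ)) {G : Ω → ℂ}
    (hG : Measurable[mpos] G) (j : ℕ) : Measurable[mpos] (G ∘ σ^[j]) := by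
  induction j with
  | zero => simpa using hG
  | succ j ih =>
    rw [Function.iterate_succ]
    exact hσ _ ih

/-- The neutral composite `ω ↦ F ω · Fc (σ^[j] ω)` of two bounded `m₊`-measurable observables is bounded and
`m₊`-measurable, when composition with `σ` preserves `m₊`-measurability. -/
theorem isBoundedMeasurable_mul_comp_iterate {Ω : Type*} {mpos : MeasurableSpace Ω} {σ : Ω → Ω}
    (hσ : ∀ G : Ω → ℂ, Measurable[mpos] G → Measurable[mpos] (G ∘ σ)) {F Fc : Ω → ℂ}
    (hF : IsBoundedMeasurable mpos F) (hFc : IsBoundedMeasurable mpos Fc) (j : ℕ) :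
    IsBoundedMeasurable mpos (fun ω => F ω * Fc (σ^[j] ω)) := by
  refine ⟨hF.1.mul (measurable_comp_iterate_of_comp hσ hFc.1 j), ?_⟩
  obtain ⟨C, hC⟩ := hF.2
  obtain ⟨C', hC'⟩ := hFc.2
  exact ⟨C * C', fun ω => norm_mul_le_of_le (hC ω) (hC' _)⟩

/-- **Haag's product bound, Euclidean form** (stub E5 of the skeleton; Haag, Local Quantum Physics,
Thm. II.5.4.1, infinite-volume Euclidean version).  For a probability measure `μ` with an Osterwalder–Schrader
realisation `IsOSRealisation μ reflect shift m₊ ι D`, a spatial shift `σ` commuting with `reflect` and `shift`,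
preserving `m₊`-measurability and MIXING on bounded measurable observables, a charged bounded positive-time
observable `F` (`∫ F dμ = 0`) and a bounded positive-time partner `Fc`: if every neutral composite
`N_j = F · Fc ∘ σʲ` clusters eventually in time at rate `r²`, then
`Re ∫ conj (F ∘ reflect) F ∘ shiftⁿ dμ · Re ∫ conj (Fc ∘ reflect) Fc ∘ shiftⁿ dμ ≤ (M_F M_{Fc})² (r²)ⁿ` for every `n`.
Proof: the operator form `HaagProductBound.stub_haag_product_bound` with `v = ι F`, `v' = ι Fc`, `w_j = ι N_j`,
`M = |M_F M_{Fc}|`, its four inputs (clustering, norm bound, no long-range order, splitting) being supplied by the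
OS dictionary and the mixing hypothesis. -/
theorem stub_euclidean_haag_product_bound :
    ∀ (Ω : Type) (mpos : MeasurableSpace Ω) [MeasurableSpace Ω] (μ : Measure Ω) [IsProbabilityMeasure μ]
      (reflect shift σ : Ω → Ω)
      (H : Type) [NormedAddCommGroup H] [InnerProductSpace ℂ H] [CompleteSpace H]
      (ι : (Ω → ℂ) → H) (D : _root_.Literature.Probability.LatticeModels.TransferData H),
      _root_.Literature.Probability.LatticeModels.IsOSRealisation μ reflect shift mpos ι D →
      Measurable reflect → Measurable shift → Measurable σ →
      (∀ G : Ω → ℂ, Measurable[mpos] G → Measurable[mpos] (G ∘ σ)) →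
      (∀ ω, reflect (σ ω) = σ (reflect ω)) → (∀ ω, shift (σ ω) = σ (shift ω)) →
      (∀ P Q : Ω → ℂ, Measurable P → Measurable Q → (∃ C : ℝ, ∀ ω, ‖P ω‖ ≤ C) → (∃ C : ℝ, ∀ ω, ‖Q ω‖ ≤ C) →
        Tendsto (fun j : ℕ => ∫ ω, P ω * Q (σ^[j] ω) ∂μ) atTop
          (nhds ((∫ ω, P ω ∂μ) * ∫ ω, Q ω ∂μ))) →
      ∀ (F Fc : Ω → ℂ) (r MF MFc : ℝ), 0 < r →
        _root_.Literature.Probability.LatticeModels.IsBoundedMeasurable mpos F →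
        _root_.Literature.Probability.LatticeModels.IsBoundedMeasurable mpos Fc →
        Measurable F → Measurable Fc → (∀ ω, ‖F ω‖ ≤ MF) → (∀ ω, ‖Fc ω‖ ≤ MFc) →
        (∫ ω, F ω ∂μ = 0) →
        (∀ j : ℕ, ∃ K : ℝ, ∀ᶠ n : ℕ in atTop,
          ‖(∫ ω, starRingEnd ℂ (F (reflect ω) * Fc (σ^[j] (reflect ω))) *
                (F (shift^[n] ω) * Fc (σ^[j] (shift^[n] ω))) ∂μ) -
              (∫ ω, starRingEnd ℂ (F (reflect ω) * Fc (σ^[j] (reflect ω))) ∂μ) *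
                ∫ ω, F ω * Fc (σ^[j] ω) ∂μ‖ ≤ K * (r ^ 2) ^ n) →
        ∀ n : ℕ,
          (∫ ω, starRingEnd ℂ (F (reflect ω)) * F (shift^[n] ω) ∂μ).re *
              (∫ ω, starRingEnd ℂ (Fc (reflect ω)) * Fc (shift^[n] ω) ∂μ).re ≤
            (MF * MFc) ^ 2 * (r ^ 2) ^ n := by
  intro Ω mpos mΩ μ hμ reflect shift σ H _ _ _ ι D hOS hreflect hshift hσ hσpos hRσ hSσ hmix F Fc r MF MFc hr
    hF hFc hFm hFcm hMF hMFc hF0 hdecay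
  -- the neutral composites `N_j = F · Fc ∘ σʲ` are bounded positive-time observables, `‖N_j‖ ≤ M_F M_{Fc}`
  have hN : ∀ j : ℕ, IsBoundedMeasurable mpos (fun ω => F ω * Fc (σ^[j] ω)) := fun j =>
    isBoundedMeasurable_mul_comp_iterate hσpos hF hFc j
  have hNb : ∀ (j : ℕ) (ω : Ω), ‖F ω * Fc (σ^[j] ω)‖ ≤ MF * MFc := fun j ω =>
    norm_mul_le_of_le (hMF ω) (hMFc _)
  -- (1) eventual clustering of each `w_j = ι N_j` at rate `r²`
  have h1 : ∀ j : ℕ, ∃ K : ℝ, ∀ᶠ n : ℕ in atTop,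
      ‖⟪ι (fun ω => F ω * Fc (σ^[j] ω)), (D.T ^ n) (ι (fun ω => F ω * Fc (σ^[j] ω)))⟫_ℂ -
          ⟪ι (fun ω => F ω * Fc (σ^[j] ω)), D.vacuum⟫_ℂ *
            ⟪D.vacuum, ι (fun ω => F ω * Fc (σ^[j] ω))⟫_ℂ‖ ≤ K * (r ^ 2) ^ n := by
    intro j
    obtain ⟨K, hK⟩ := hdecay j
    refine ⟨K, hK.mono fun n hn => ?_⟩
    rwa [hOS.integral_conj_comp_reflect_mul_comp_iterate (hN j) (hN j) n,
      hOS.integral_conj_comp_reflect (hN j), hOS.integral_eq_inner_vacuum (hN j)] at hn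
  -- (2) the uniform norm bound `‖w_j‖ ≤ |M_F M_{Fc}|`
  have h2 : ∀ j : ℕ, ‖ι (fun ω => F ω * Fc (σ^[j] ω))‖ ≤ |MF * MFc| := by
    intro j
    have hb : ‖∫ ω, starRingEnd ℂ (F (reflect ω) * Fc (σ^[j] (reflect ω))) * (F ω * Fc (σ^[j] ω)) ∂μ‖ ≤
        (MF * MFc) * (MF * MFc) := by
      have h0 : ∀ᵐ ω ∂μ, ‖starRingEnd ℂ (F (reflect ω) * Fc (σ^[j] (reflect ω))) * (F ω * Fc (σ^[j] ω))‖ ≤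
          (MF * MFc) * (MF * MFc) :=
        Eventually.of_forall fun ω => norm_conj_mul_le (hNb j (reflect ω)) (hNb j ω)
      have h0' := norm_integral_le_of_norm_le_const h0
      rwa [probReal_univ, mul_one] at h0'
    have hsq : ‖ι (fun ω => F ω * Fc (σ^[j] ω))‖ ^ 2 ≤ |MF * MFc| ^ 2 := by
      rw [← hOS.re_integral_conj_comp_reflect_mul_self (hN j), sq_abs, sq]
      exact (RCLike.re_le_norm _).trans hb
    exact (pow_le_pow_iff_left₀ (norm_nonneg _) (abs_nonneg _) two_ne_zero).1 hsq
  -- (3) no long-range order `⟪Ω, w_j⟫ = ∫ F · Fc ∘ σʲ dμ → (∫ F)(∫ Fc) = 0` (mixing, `∫ F = 0`)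
  have h3 : Tendsto (fun j : ℕ => ⟪D.vacuum, ι (fun ω => F ω * Fc (σ^[j] ω))⟫_ℂ) atTop (𝓝 0) := by
    have h := hmix F Fc hFm hFcm ⟨MF, hMF⟩ ⟨MFc, hMFc⟩
    rw [hF0, zero_mul] at h
    exact h.congr fun j => hOS.integral_eq_inner_vacuum (hN j)
  -- (4) splitting `⟪w_j, Tⁿ w_j⟫ → ⟪ι F, Tⁿ ι F⟫ ⟪ι Fc, Tⁿ ι Fc⟫` (mixing of `P · Q ∘ σʲ`)
  have h4 : ∀ n : ℕ, Tendsto (fun j : ℕ =>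
      ⟪ι (fun ω => F ω * Fc (σ^[j] ω)), (D.T ^ n) (ι (fun ω => F ω * Fc (σ^[j] ω)))⟫_ℂ -
        ⟪ι F, (D.T ^ n) (ι F)⟫_ℂ * ⟪ι Fc, (D.T ^ n) (ι Fc)⟫_ℂ) atTop (𝓝 0) := by
    intro n
    refine tendsto_sub_nhds_zero_iff.2 ?_
    have hPm : Measurable fun ω => starRingEnd ℂ (F (reflect ω)) * F (shift^[n] ω) :=
      (Complex.continuous_conj.measurable.comp (hFm.comp hreflect)).mul (hFm.comp (hshift.iterate n))
    have hQm : Measurable fun ω => starRingEnd ℂ (Fc (reflect ω)) * Fc (shift^[n] ω) :=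
      (Complex.continuous_conj.measurable.comp (hFcm.comp hreflect)).mul (hFcm.comp (hshift.iterate n))
    have hPb : ∃ C : ℝ, ∀ ω, ‖starRingEnd ℂ (F (reflect ω)) * F (shift^[n] ω)‖ ≤ C :=
      ⟨MF * MF, fun ω => norm_conj_mul_le (hMF _) (hMF _)⟩
    have hQb : ∃ C : ℝ, ∀ ω, ‖starRingEnd ℂ (Fc (reflect ω)) * Fc (shift^[n] ω)‖ ≤ C :=
      ⟨MFc * MFc, fun ω => norm_conj_mul_le (hMFc _) (hMFc _)⟩
    have h := hmix _ _ hPm hQm hPb hQb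
    rw [hOS.integral_conj_comp_reflect_mul_comp_iterate hF hF n,
      hOS.integral_conj_comp_reflect_mul_comp_iterate hFc hFc n] at h
    refine h.congr fun j => ?_
    rw [← hOS.integral_conj_comp_reflect_mul_comp_iterate (hN j) (hN j) n]
    refine integral_congr_ae (Eventually.of_forall fun ω => ?_)
    beta_reduce
    rw [apply_iterate_comm hRσ j ω, iterate_iterate_comm hSσ n j ω, map_mul]
    ring
  -- the operator form (E4) and the dictionary in reverse
  have key := HaagProductBound.stub_haag_product_bound H D (ι F) (ι Fc)
    (fun j => ι (fun ω => F ω * Fc (σ^[j] ω))) r |MF * MFc| hr h1 h2 h3 h4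
  intro n
  have hn := key n
  rw [sq_abs, ← hOS.integral_conj_comp_reflect_mul_comp_iterate hF hF n,
    ← hOS.integral_conj_comp_reflect_mul_comp_iterate hFc hFc n] at hn
  exact hn

end Summit.QuantumFields.QCD.Cruxes.TorusHalfSpectrum.Birth.EuclideanHaag
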